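import Mathlib
import HarnessLib
import Summits.Ventures.LatticeQCDFlow.Scoring.SplitChainTimeAverageResidual
import Summits.Ventures.LatticeQCDFlow.Scoring.RegenerativeCLT

/-!
# THE CENTRAL LIMIT THEOREM FOR TIME AVERAGES OF A DOEBLIN CHAIN, from any initial law:
# `√n · ((1/n) Σ_{t<n} f(X_t) − π(f)) ⇒ N(0, σ²_f)` with the Green–Kubo variance

HONEST FRAMING: exact (Metropolis-corrected) sampling algorithms for lattice gauge theory;
figures of merit are autocorrelation/cost numbers at stated couplings and volumes; no
continuum-physics claim.

Venture `LatticeQCDFlow` (cell pub-lqcd), topic `Scoring`; FANOUT row 8 (`s0-cpn-nemc`, GEN-18).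
NEW WORK of the cell, not a published result; no definition is introduced.  Setting: a Markov
kernel `κ` on a measurable space with invariant probability `π` and a Doeblin minorisation
`κ(x, ·) ≥ ε ν` (`0 < ε < 1`, `ν` any probability law) — every exact sampler of the venture whose
certificate is such an `ε` (the exact flow sampler on `SU(n)^E`, independence Metropolis with
bounded weights, the restart chain of the non-equilibrium protocol); `f` bounded measurable,
`σ²_f = Var_π f + 2 Σ_{k≥1} Cov_π(f, κ^k f)` the Green–Kubo asymptotic variance (the `τ_int`
variance: `σ²_f = Var_π(f) · 2τ_int`).  THE THEOREM: for EVERY initial law `μ₀`, under the chain's path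
law, `(√n)⁻¹ Σ_{t<n} (f(X_t) − π f)` converges in distribution to `N(0, σ²_f)`.  Hence the usual
MCMC error bar `σ_f/√n` (with `σ²_f` from the integrated autocorrelation time) is asymptotically
exact, not only an upper bound — complementing the row's CLT-free certificates.  Proof (all on the
tree): realise the chain as the state path of the split chain (`Scoring/SplitChain.lean`:
identity of path laws); decompose the time sum into `Z_0 +` (the centred tour sums of the tours
started by time `n−1`) `−` (the residual of the tour in progress)
(`Scoring/SplitChainTimeAverageResidual.lean`); the tour sums are i.i.d.
(`Scoring/SplitChainTourIID.lean`) with variance `σ²_f/e` (`Scoring/TourVarianceGeneral.lean`), so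
`(√R)⁻¹ Σ_{i≤R} Z_i ⇒ N(0, σ²_f/e)` (`Scoring/RegenerativeCLT.lean`, Mathlib's CLT), and along
`R = ⌊e n⌋` with the factor `√(⌊e n⌋/n) → √e` (Slutsky) the main term converges to `N(0, σ²_f)`;
the difference is `o_P(1)` by the second-moment Anscombe step (`Scoring/SplitChainAnscombe.lean`)
and the geometric residual, and `MeasureTheory.tendstoInDistribution_of_tendstoInMeasure_sub`
concludes.  Printed counterpart NAMED ONLY: the CLT for uniformly ergodic / Doeblin chains
(Doeblin 1938; Chung 1960 §I.16; Meyn–Tweedie 1993 Thm 17.0.1; Kipnis–Varadhan 1986 for the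
reversible case) — nothing is cited as a fact; to our knowledge Mathlib has the i.i.d. CLT only.

## Content (`π` invariant, `κ(x, ·) ≥ ε ν`, `0 < ε < 1`, `|f| ≤ C` measurable)

* **`splitChain_timeAverage_clt`** — for the split chain from any initial law on `Ω × Bool`;
* **`markovChain_clt`** — THE THEOREM: for every initial law `μ₀` on `Ω` and every `Y` with law
  `N(0, σ²_f)`, `TendstoInDistribution (fun n x => (√n)⁻¹ Σ_{t<n} (f(x t) − π f)) atTop Y P_{μ₀} P'`.

(Instance binders `[IsProbabilityMeasure P]` are `inferInstance` at call sites; see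
`Scoring/RegenerativeCLT.lean`.)  NOT CLAIMED: a rate (Berry–Esseen); unbounded `f`; `σ²_f > 0`;
chains without a whole-space minorisation (general Harris chains need the first-entrance split).
-/

noncomputable section

namespace Summit.Ventures.LatticeQCDFlow.Scoring

open MeasureTheory ProbabilityTheory Filter Finset Preorder Literature.Probability.MarkovChains
open scoped ENNReal Topology

section CLT

variable {Ω : Type*} [MeasurableSpace Ω]
  {κ : Kernel Ω Ω} [IsMarkovKernel κ] {ν : Measure Ω} [IsProbabilityMeasure ν] {ε : ℝ≥0∞}
  {hmin : ∀ x {B : Set Ω}, MeasurableSet B → ε * ν B ≤ κ x B}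
  (κs : Kernel (Ω × Bool) (Ω × Bool)) [IsMarkovKernel κs]
  (μs : Measure (Ω × Bool)) [IsProbabilityMeasure μs]

/-- **CLT FOR THE TIME AVERAGE OF THE SPLIT CHAIN'S STATE PATH**, any initial law: for `Y` with law
`N(0, σ²_f)`, `(√n)⁻¹ Σ_{t<n} (f(X_t) − π f) ⇒ Y`. -/
theorem splitChain_timeAverage_clt {π : Measure Ω} [IsProbabilityMeasure π]
    (hπ : Kernel.Invariant κ π) (hε0 : 0 < ε) (hε : ε < 1)
    (hκs : ∀ p, κs p = (ε • ν).map (fun y : Ω => (y, true))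
      + ((1 - ε) • Doeblin.residualKernel κ ν ε hmin p.1).map (fun y : Ω => (y, false)))
    {f : Ω → ℝ} (hf : Measurable f) {C : ℝ} (hC : ∀ x, |f x| ≤ C)
    {Ω' : Type*} [MeasurableSpace Ω'] {P' : Measure Ω'} [IsProbabilityMeasure P'] {Y : Ω' → ℝ}
    (hY : HasLaw Y (gaussianReal 0 (Real.toNNReal ((∫ y, (f y - ∫ z, f z ∂π) ^ 2 ∂π)
      + 2 * ∑' k, ∫ y, (f y - ∫ z, f z ∂π) * (kop κ)^[k + 1] (fun y => f y - ∫ z, f z ∂π) y ∂π))) P')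
    [IsProbabilityMeasure (Kernel.trajMeasure (X := fun _ : ℕ => Ω × Bool) μs
        (fun n : ℕ => κs.comap (fun h : (i : ↥(Finset.Iic n)) → Ω × Bool =>
          h ⟨n, Finset.mem_Iic.2 le_rfl⟩) (measurable_pi_apply _)))] :
    TendstoInDistribution (fun (n : ℕ) (x : ℕ → Ω × Bool) =>
        (Real.sqrt n)⁻¹ * ∑ t ∈ Finset.range n, (f (x t).1 - ∫ z, f z ∂π))
      atTop Y (fun _ => (Kernel.trajMeasure (X := fun _ : ℕ => Ω × Bool) μs
        (fun n : ℕ => κs.comap (fun h : (i : ↥(Finset.Iic n)) → Ω × Bool =>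
          h ⟨n, Finset.mem_Iic.2 le_rfl⟩) (measurable_pi_apply _)))) P' := by
  set P := (Kernel.trajMeasure (X := fun _ : ℕ => Ω × Bool) μs
        (fun n : ℕ => κs.comap (fun h : (i : ↥(Finset.Iic n)) → Ω × Bool =>
          h ⟨n, Finset.mem_Iic.2 le_rfl⟩) (measurable_pi_apply _))) with hP
  set c := ∫ z, f z ∂π with hc
  set σ2 := ((∫ y, (f y - ∫ z, f z ∂π) ^ 2 ∂π)
      + 2 * ∑' k, ∫ y, (f y - ∫ z, f z ∂π) * (kop κ)^[k + 1] (fun y => f y - ∫ z, f z ∂π) y ∂π) with hσ2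
  have he0 : 0 < ε.toReal := ENNReal.toReal_pos hε0.ne' (ne_top_of_lt hε)
  have he1 : ε.toReal ≤ 1 := ENNReal.toReal_le_of_le_ofReal zero_le_one
    (by rw [ENNReal.ofReal_one]; exact hε.le)
  have hse0 : 0 < Real.sqrt ε.toReal := Real.sqrt_pos.2 he0
  have hσ0 : 0 ≤ σ2 := asymptoticVariance_nonneg_minorised (κ := κ) (ν := ν) hπ hmin hε0 hε hf hC
  obtain ⟨hg, -, -⟩ := centred_observable_bounds π hf hC
  -- the tour CLT with the rescaled Gaussian `Y / √e ~ N(0, σ²/e)`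
  have hY₁ : HasLaw (fun ω => (Real.sqrt ε.toReal)⁻¹ * Y ω) (gaussianReal 0 (σ2 / ε.toReal).toNNReal) P' := by
    refine ⟨hY.aemeasurable.const_mul _, ?_⟩
    rw [show (fun ω => (Real.sqrt ε.toReal)⁻¹ * Y ω) = (fun a : ℝ => (Real.sqrt ε.toReal)⁻¹ * a) ∘ Y
        from rfl,
      ← AEMeasurable.map_map_of_aemeasurable (measurable_const_mul _).aemeasurable hY.aemeasurable,
      hY.map_eq, gaussianReal_map_const_mul, mul_zero]
    congr 1
    apply NNReal.coe_injective
    rw [NNReal.coe_mul, NNReal.coe_mk, Real.coe_toNNReal _ hσ0, Real.coe_toNNReal _ (div_nonneg hσ0 he0.le),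
      inv_pow, Real.sq_sqrt he0.le]
    field_simp
  have hT := splitChain_centredTourSum_clt κs μs (κ := κ) (ν := ν) (hmin := hmin) hπ hε0 hε hκs hf hC hY₁
  -- along the subsequence `a n = ⌊e n⌋`
  set a : ℕ → ℕ := fun n => ⌊ε.toReal * n⌋₊ with ha
  have ha_tend : Tendsto a atTop atTop :=
    tendsto_nat_floor_atTop.comp ((tendsto_natCast_atTop_atTop (R := ℝ)).const_mul_atTop he0)
  have hTa : TendstoInDistribution (fun (n : ℕ) (x : ℕ → Ω × Bool) =>
      (Real.sqrt (a n))⁻¹ * ∑ i ∈ Finset.range (a n), (∑' u, (if (∑ s ∈ Finset.range u, (if (x (s + 1)).2 then (1 : ℕ) else 0)) = i + 1 then (1 : ℝ) else 0) * (f (x u).1 - ∫ z, f z ∂π)))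
      atTop (fun ω => (Real.sqrt ε.toReal)⁻¹ * Y ω) (fun _ => P) P' :=
    ⟨fun n => hT.forall_aemeasurable (a n), hT.aemeasurable_limit, hT.tendsto.comp ha_tend⟩
  -- the deterministic factor `√(a n)/√n → √e`
  have hcn : Tendsto (fun n : ℕ => Real.sqrt (a n) / Real.sqrt n) atTop (𝓝 (Real.sqrt ε.toReal)) := by
    have h1 : Tendsto (fun n : ℕ => ((a n : ℕ) : ℝ) / n) atTop (𝓝 ε.toReal) :=
      (tendsto_nat_floor_mul_div_atTop he0.le).comp (tendsto_natCast_atTop_atTop (R := ℝ))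
    have h2 := (Real.continuous_sqrt.tendsto _).comp h1
    refine h2.congr fun n => ?_
    simp only [Function.comp_apply]
    rw [Real.sqrt_div (Nat.cast_nonneg _)]
  have hcM : TendstoInMeasure P (fun (n : ℕ) (_ : ℕ → Ω × Bool) => Real.sqrt (a n) / Real.sqrt n)
      atTop (fun _ => Real.sqrt ε.toReal) :=
    tendstoInMeasure_of_tendsto_ae (fun n => aestronglyMeasurable_const) (ae_of_all _ fun _ => hcn)
  -- Slutsky with `(y, c) ↦ c · y`
  have hS := hTa.continuous_comp_prodMk_of_tendstoInMeasure_const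
    (g := fun p : ℝ × ℝ => p.2 * p.1) (by fun_prop) hcM (fun n => aemeasurable_const)
  have hM : TendstoInDistribution (fun (n : ℕ) (x : ℕ → Ω × Bool) =>
      (Real.sqrt n)⁻¹ * ∑ i ∈ Finset.range (a n), (∑' u, (if (∑ s ∈ Finset.range u, (if (x (s + 1)).2 then (1 : ℕ) else 0)) = i + 1 then (1 : ℝ) else 0) * (f (x u).1 - ∫ z, f z ∂π))) atTop Y (fun _ => P) P' := by
    refine hS.congr (fun n => ae_of_all _ fun x => ?_) (ae_of_all _ fun ω => ?_)
    · show Real.sqrt (a n) / Real.sqrt n * ((Real.sqrt (a n))⁻¹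
        * ∑ i ∈ Finset.range (a n), (∑' u, (if (∑ s ∈ Finset.range u, (if (x (s + 1)).2 then (1 : ℕ) else 0)) = i + 1 then (1 : ℝ) else 0) * (f (x u).1 - ∫ z, f z ∂π)))
        = (Real.sqrt n)⁻¹ * ∑ i ∈ Finset.range (a n), (∑' u, (if (∑ s ∈ Finset.range u, (if (x (s + 1)).2 then (1 : ℕ) else 0)) = i + 1 then (1 : ℝ) else 0) * (f (x u).1 - ∫ z, f z ∂π))
      rcases Nat.eq_zero_or_pos (a n) with h0 | h0
      · rw [h0]; simp
      · have hsa : Real.sqrt (a n) ≠ 0 := (Real.sqrt_pos.2 (Nat.cast_pos.2 h0)).ne'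
        rw [← mul_assoc, div_mul_eq_mul_div, mul_inv_cancel₀ hsa, one_div]
    · show Real.sqrt ε.toReal * ((Real.sqrt ε.toReal)⁻¹ * Y ω) = Y ω
      rw [← mul_assoc, mul_inv_cancel₀ hse0.ne', one_mul]
  -- the residual is negligible
  have hres := splitChain_timeAverage_sub_tourSums_tendstoInMeasure κs μs (κ := κ) (ν := ν)
    (hmin := hmin) hπ hε0 hε hκs hf hC
  rw [← hP] at hres
  have hSm : ∀ n : ℕ, Measurable fun x : ℕ → Ω × Bool =>
      (Real.sqrt n)⁻¹ * ∑ t ∈ Finset.range n, (f (x t).1 - c) := fun n =>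
    measurable_const.mul (Finset.measurable_sum _ fun t _ =>
      hg.comp (measurable_fst.comp (measurable_pi_apply t)))
  refine tendstoInDistribution_of_tendstoInMeasure_sub _ Y hM ?_ (fun n => (hSm n).aemeasurable)
  refine hres.congr (fun n => ae_of_all _ fun x => ?_) (ae_of_all _ fun x => rfl)
  exact mul_sub _ _ _

/-- **THE MARKOV-CHAIN CENTRAL LIMIT THEOREM FOR A DOEBLIN KERNEL, FROM ANY INITIAL LAW.**
`κ` Markov with invariant probability `π` and `κ(x, ·) ≥ ε ν` (`0 < ε < 1`), `|f| ≤ C` measurable,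
`σ²_f = ∫ f̄² dπ + 2 Σ_{k≥1} ∫ f̄ · κ^k f̄ dπ`; `μ₀` ANY initial law, `P_{μ₀}` the chain's path law.
For every real random variable `Y` with law `N(0, σ²_f)`:
`TendstoInDistribution (fun n x => (√n)⁻¹ Σ_{t<n} (f(x_t) − π f)) atTop Y (fun _ => P_{μ₀}) P'`. -/
theorem markovChain_clt {π : Measure Ω} [IsProbabilityMeasure π]
    (hπ : Kernel.Invariant κ π) (hmin : ∀ x {B : Set Ω}, MeasurableSet B → ε * ν B ≤ κ x B)
    (hε0 : 0 < ε) (hε : ε < 1)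
    {f : Ω → ℝ} (hf : Measurable f) {C : ℝ} (hC : ∀ x, |f x| ≤ C)
    (μ₀ : Measure Ω) [IsProbabilityMeasure μ₀]
    {Ω' : Type*} [MeasurableSpace Ω'] {P' : Measure Ω'} [IsProbabilityMeasure P'] {Y : Ω' → ℝ}
    (hY : HasLaw Y (gaussianReal 0 (Real.toNNReal ((∫ y, (f y - ∫ z, f z ∂π) ^ 2 ∂π)
      + 2 * ∑' k, ∫ y, (f y - ∫ z, f z ∂π) * (kop κ)^[k + 1] (fun y => f y - ∫ z, f z ∂π) y ∂π))) P')
    [IsProbabilityMeasure (Kernel.trajMeasure (X := fun _ : ℕ => Ω) μ₀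
        (fun n : ℕ => κ.comap (fun h : (i : ↥(Finset.Iic n)) → Ω => h ⟨n, Finset.mem_Iic.2 le_rfl⟩)
          (measurable_pi_apply _)))] :
    TendstoInDistribution (fun (n : ℕ) (x : ℕ → Ω) =>
        (Real.sqrt n)⁻¹ * ∑ t ∈ Finset.range n, (f (x t) - ∫ z, f z ∂π))
      atTop Y (fun _ => (Kernel.trajMeasure (X := fun _ : ℕ => Ω) μ₀
        (fun n : ℕ => κ.comap (fun h : (i : ↥(Finset.Iic n)) → Ω => h ⟨n, Finset.mem_Iic.2 le_rfl⟩)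
          (measurable_pi_apply _)))) P' := by
  obtain ⟨κs, hκsM, hκs⟩ := exists_splitKernel (κ := κ) (ν := ν) (hmin := hmin) hε
  set μs : Measure (Ω × Bool) := μ₀.map (fun y : Ω => (y, true)) with hμs
  haveI : IsProbabilityMeasure μs := Measure.isProbabilityMeasure_map (measurable_tagCoin true).aemeasurable
  haveI hPs : IsProbabilityMeasure (Kernel.trajMeasure (X := fun _ : ℕ => Ω × Bool) μs
        (fun n : ℕ => κs.comap (fun h : (i : ↥(Finset.Iic n)) → Ω × Bool =>
          h ⟨n, Finset.mem_Iic.2 le_rfl⟩) (measurable_pi_apply _))) := inferInstance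
  have hclt := splitChain_timeAverage_clt κs μs (κ := κ) (ν := ν) (hmin := hmin) hπ hε0 hε hκs hf hC hY
  obtain ⟨hg, -, -⟩ := centred_observable_bounds π hf hC
  -- the state path of the split chain has the law of the `κ`-chain from `μ₀`
  have hfst : μs.map Prod.fst = μ₀ := by
    rw [hμs, Measure.map_map measurable_fst (measurable_tagCoin true)]
    exact Measure.map_id
  have hlaw := splitChain_map_fst κs μs (κ := κ) (ν := ν) (hmin := hmin) hε hκs
  rw [hfst] at hlaw
  have hstate : Measurable (fun (x : ℕ → Ω × Bool) (n : ℕ) => (x n).1) :=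
    measurable_pi_lambda _ fun n => measurable_fst.comp (measurable_pi_apply n)
  have hGm : ∀ n : ℕ, Measurable fun x : ℕ → Ω =>
      (Real.sqrt n)⁻¹ * ∑ t ∈ Finset.range n, (f (x t) - ∫ z, f z ∂π) := fun n =>
    measurable_const.mul (Finset.measurable_sum _ fun t _ => hg.comp (measurable_pi_apply t))
  refine ⟨fun n => (hGm n).aemeasurable, hY.aemeasurable, ?_⟩
  convert hclt.tendsto using 2 with n
  apply Subtype.ext
  show ((Kernel.trajMeasure (X := fun _ : ℕ => Ω) μ₀
        (fun n : ℕ => κ.comap (fun h : (i : ↥(Finset.Iic n)) → Ω => h ⟨n, Finset.mem_Iic.2 le_rfl⟩)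
          (measurable_pi_apply _)))).map _ = ((Kernel.trajMeasure (X := fun _ : ℕ => Ω × Bool) μs
        (fun n : ℕ => κs.comap (fun h : (i : ↥(Finset.Iic n)) → Ω × Bool =>
          h ⟨n, Finset.mem_Iic.2 le_rfl⟩) (measurable_pi_apply _)))).map _
  rw [← hlaw, Measure.map_map (hGm n) hstate]
  rfl

end CLT

end Summit.Ventures.LatticeQCDFlow.Scoring

end
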